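import Literature.Analysis.Complex.CauchyTransformSupport
import Literature.Analysis.FunctionSpaces.ContDiffHolderMollify
import Literature.Analysis.FunctionSpaces.ContDiffHolderInterpolation
import HarnessLib

/-!
# The Cauchy transform on `C^{0,r}` densities in a disc: extension of the a priori estimate

For a complex Banach space `F` and `0 < r < 1`, suppose that the one-variable Cauchy transform
`T g = cauchyTransformAlong 1 g`, `(T g)(z) = ∫ (π t)⁻¹ • g (z - t) dA(t)`
(`Literature/Analysis/Complex/CauchyTransform.lean`), satisfies the a priori `C^{1,r}` estimate
for SMOOTH densities supported in a disc (`CauchyTransformHolderApriori F r`): for every radius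
`ρ` there is `C` with `‖T g‖_∞ ≤ C K₀`, `‖D(T g)‖_∞ ≤ C (K₀ + K₁)`, `[D(T g)]_r ≤ C (K₀ + K₁)`
whenever `g ∈ C^∞`, `g = 0` off the disc `‖z‖ < ρ`, `‖g‖ ≤ K₀` and `[g]_r ≤ K₁`. Then the same three
bounds hold for every CONTINUOUS density `g` with these bounds, and moreover `T g ∈ C¹` with
`∂̄ (T g) = g` (`cauchyTransform_holder_of_apriori`). This is the classical statement that `T`
maps `C^{0,r}` densities with support in a disc boundedly into `C^{1,r}` (Vekua 1962, Ch. I,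
Thm. 1.32), reduced to the smooth case.

Proof: mollify (`Literature.Analysis.FunctionSpaces.exists_contDiff_approx_of_holderWith`:
smooth `gₙ` with the SAME sup and Hölder bounds, `‖gₙ - g‖_∞ ≤ K₁ εₙ ^ r`, support in the
`εₙ`-neighbourhood of the support of `g`, `εₙ → 0`, `εₙ < ρ`); the a priori estimate at radius
`2ρ` bounds the `T gₙ` in `C^{1,r}` uniformly in `n`; `T gₙ → T g` uniformly on `ℂ` by the uniform
sup bound `‖T h‖_∞ ≤ 6 R ‖h‖_∞` for densities supported in `B(0, R)`
(`norm_cauchyTransform_le_uniform`); the interpolation inequality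
`‖Df(x)‖ ≤ 2‖f‖_∞ / h + sup_{B̄(x,h)} ‖Df - Df(x)‖`
(`Literature.Analysis.FunctionSpaces.norm_fderiv_le_of_modulus`) applied to `f = T gₙ - T gₘ`,
whose derivative has the uniform Hölder modulus `2 C (K₀ + K₁) h ^ r`, makes `(D(T gₙ))ₙ`
uniformly Cauchy on `ℂ` (`uniformCauchySeqOn_fderiv_of_holder`); hence `T g ∈ C¹` and
`D(T gₙ) → D(T g)` uniformly (`hasFDerivAt_of_tendstoUniformly`,
`exists_hasFDerivAt_of_uniformCauchySeqOn_fderiv`), and the three bounds as well as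
`∂̄ (T gₙ) = gₙ` (Hörmander, Thm. 1.2.2, `dbarAlong_cauchyTransformAlong`) pass to the limit.
No subsequence (Arzelà–Ascoli) is needed, and `F` need not be finite-dimensional for the proof.

## References

* I. N. Vekua, *Generalized Analytic Functions* (1962), Ch. I, §5–§6, Thm. 1.32.
* L. Hörmander, *An Introduction to Complex Analysis in Several Variables*, 2nd ed. (1973),
  Thm. 1.2.2. [HormanderSCV1973]
* D. Gilbarg, N. S. Trudinger, *Elliptic Partial Differential Equations of Second Order* (2001),
  §7.2 (mollification) and Lemma 6.35 (interpolation). [GilbargTrudinger2001]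
-/

noncomputable section

open Set Metric MeasureTheory Filter Function
open scoped NNReal ContDiff Topology

namespace Literature.Analysis.Complex

open Literature.Analysis.FunctionSpaces

/-- **The a priori `C^{1,r}` estimate for the Cauchy transform of smooth densities in a disc**
(statement): for every radius `ρ > 0` there is `C ≥ 0` such that for all `g ∈ C^∞(ℂ, F)`
vanishing for `‖z‖ ≥ ρ`, with `‖g‖ ≤ K₀` and `‖g z - g z'‖ ≤ K₁ ‖z - z'‖ ^ r`, the Cauchy transform
satisfies `‖T g‖ ≤ C K₀`, `‖D(T g)‖ ≤ C (K₀ + K₁)` and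
`‖D(T g)(z) - D(T g)(z')‖ ≤ C (K₀ + K₁) ‖z - z'‖ ^ r`. [folklore] -/
def CauchyTransformHolderApriori (F : Type) [NormedAddCommGroup F] [NormedSpace ℂ F]
    [CompleteSpace F] (r : ℝ≥0) : Prop :=
  ∀ ρ : ℝ, 0 < ρ → ∃ C : ℝ, 0 ≤ C ∧ ∀ g : ℂ → F, ContDiff ℝ ∞ g → (∀ z, ρ ≤ ‖z‖ → g z = 0) →
    ∀ K₀ K₁ : ℝ, 0 ≤ K₀ → 0 ≤ K₁ → (∀ z, ‖g z‖ ≤ K₀) →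
      (∀ z z', ‖g z - g z'‖ ≤ K₁ * ‖z - z'‖ ^ (r : ℝ)) →
      (∀ z, ‖cauchyTransformAlong (1 : ℂ) g z‖ ≤ C * K₀) ∧
      (∀ z, ‖fderiv ℝ (cauchyTransformAlong (1 : ℂ) g) z‖ ≤ C * (K₀ + K₁)) ∧
      (∀ z z', ‖fderiv ℝ (cauchyTransformAlong (1 : ℂ) g) z -
          fderiv ℝ (cauchyTransformAlong (1 : ℂ) g) z'‖ ≤ C * (K₀ + K₁) * ‖z - z'‖ ^ (r : ℝ))

/-! ### A uniform sup bound and support bookkeeping -/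

section Helpers

variable {F : Type*} [NormedAddCommGroup F] [NormedSpace ℂ F]

/-- **Uniform sup bound for the Cauchy transform of a density supported in a disc.** If
`‖h‖ ≤ G` everywhere and `h` vanishes off `B(0, R)`, then `‖(T h)(w)‖ ≤ 6 R G` for EVERY `w ∈ ℂ`:
for `‖w‖ ≤ 2R` this is the bound `2 (2R + R) G` of
`SimilarityVector.norm_cauchyTransform_le_of_norm_le`; for `‖w‖ > 2R` the kernel `(π t)⁻¹` is
bounded by `(π R)⁻¹` on the support of `t ↦ h (w - t)`, a disc of area `π R²`, whence
`‖(T h)(w)‖ ≤ R G`. [folklore] -/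
theorem norm_cauchyTransform_le_uniform {h : ℂ → F} {R G : ℝ} (hR : 0 ≤ R) (hG : 0 ≤ G)
    (hsupp : ∀ z, h z ≠ 0 → ‖z‖ < R) (hbound : ∀ z, ‖h z‖ ≤ G) (w : ℂ) :
    ‖cauchyTransformAlong (1 : ℂ) h w‖ ≤ 6 * R * G := by
  rcases hR.eq_or_lt with rfl | hR0
  · have h0 : ∀ z, h z = 0 := fun z => by
      by_contra hz
      exact absurd (hsupp z hz) (not_lt.2 (norm_nonneg z))
    simp [cauchyTransformAlong_apply, h0]
  by_cases hw : ‖w‖ ≤ 2 * R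
  · calc ‖cauchyTransformAlong (1 : ℂ) h w‖ ≤ 2 * (2 * R + R) * G :=
          SimilarityVector.norm_cauchyTransform_le_of_norm_le hR hG hsupp hbound hw
      _ = 6 * R * G := by ring
  rw [not_le] at hw
  -- pointwise bound of the integrand by `(π R)⁻¹ G` on the disc `B(w, R)`
  have hpt : ∀ t : ℂ, ‖((↑Real.pi * t)⁻¹ : ℂ) • h (w - t)‖ ≤
      (ball w R).indicator (fun _ => (Real.pi * R)⁻¹ * G) t := by
    intro t
    by_cases ht : h (w - t) = 0
    · rw [ht, smul_zero, norm_zero]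
      exact indicator_nonneg (fun _ _ => by positivity) t
    · have hwt : ‖w - t‖ < R := hsupp _ ht
      have htmem : t ∈ ball w R := by rwa [mem_ball, dist_comm, dist_eq_norm]
      have hRt : R ≤ ‖t‖ := by
        have := norm_sub_norm_le w t
        linarith
      rw [indicator_of_mem htmem, norm_smul, norm_inv, norm_mul, Complex.norm_real,
        Real.norm_of_nonneg Real.pi_pos.le]
      refine mul_le_mul ?_ (hbound _) (norm_nonneg _) (by positivity)
      exact inv_anti₀ (by positivity) (by gcongr)
  have hint : Integrable ((ball w R).indicator fun _ : ℂ => (Real.pi * R)⁻¹ * G) volume :=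
    (integrable_indicator_iff measurableSet_ball).2
      (integrableOn_const (show volume (ball w R) ≠ ⊤ from measure_ball_lt_top.ne))
  have hvol : volume.real (ball w R) = R ^ 2 * Real.pi := by
    rw [measureReal_def, Complex.volume_ball, ENNReal.toReal_mul, ENNReal.toReal_pow,
      ENNReal.toReal_ofReal hR, ENNReal.coe_toReal, NNReal.coe_real_pi]
  rw [cauchyTransformAlong_one_apply]
  calc ‖∫ t, ((↑Real.pi * t)⁻¹ : ℂ) • h (w - t)‖ ≤ ∫ t, ‖((↑Real.pi * t)⁻¹ : ℂ) • h (w - t)‖ :=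
        norm_integral_le_integral_norm _
    _ ≤ ∫ t, (ball w R).indicator (fun _ => (Real.pi * R)⁻¹ * G) t :=
        integral_mono_of_nonneg (Eventually.of_forall fun t => norm_nonneg _) hint
          (Eventually.of_forall hpt)
    _ = volume.real (ball w R) * ((Real.pi * R)⁻¹ * G) := by
        rw [integral_indicator_const _ measurableSet_ball, smul_eq_mul]
    _ = R * G := by
        rw [hvol]
        field_simp
    _ ≤ 6 * R * G := by nlinarith [mul_nonneg hR0.le hG]

omit [NormedSpace ℂ F] in
/-- A function vanishing for `ρ ≤ ‖z‖` has `tsupport ⊆ B̄(0, ρ)`. [folklore] -/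
theorem tsupport_subset_closedBall_of_eq_zero {g : ℂ → F} {ρ : ℝ}
    (hg : ∀ z, ρ ≤ ‖z‖ → g z = 0) : tsupport g ⊆ closedBall (0 : ℂ) ρ := by
  refine closure_minimal (fun z hz => ?_) isClosed_closedBall
  rw [mem_closedBall, dist_zero_right]
  by_contra h
  exact hz (hg z (le_of_lt (not_le.1 h)))

/-! ### Uniformly Cauchy derivatives by interpolation, and the `C¹` limit -/

/-- **Uniformly Cauchy derivatives by interpolation.** Let `u n : X → G` be differentiable maps
between real normed spaces whose derivatives have a common Hölder modulus,
`‖D(u n)(x) - D(u n)(y)‖ ≤ H ‖x - y‖ ^ r` (`r > 0`), and which are uniformly Cauchy in sup norm.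
Then the derivatives `D(u n)` are uniformly Cauchy on the whole space: by the interpolation
inequality `norm_fderiv_le_of_modulus` applied to `u n - u m`,
`‖D(u n)(x) - D(u m)(x)‖ ≤ 2 ‖u n - u m‖_∞ / h + 2 H h ^ r` for every `h > 0`.
[cite: GilbargTrudinger2001, Lemma 6.35] -/
theorem uniformCauchySeqOn_fderiv_of_holder {X G : Type*} [NormedAddCommGroup X]
    [NormedSpace ℝ X] [NormedAddCommGroup G] [NormedSpace ℝ G] {u : ℕ → X → G}
    (hu : ∀ n, Differentiable ℝ (u n)) {H r : ℝ} (hH : 0 ≤ H) (hr : 0 < r)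
    (hHol : ∀ n x y, ‖fderiv ℝ (u n) x - fderiv ℝ (u n) y‖ ≤ H * ‖x - y‖ ^ r)
    (hC : ∀ η > 0, ∃ N, ∀ n ≥ N, ∀ m ≥ N, ∀ x, ‖u n x - u m x‖ ≤ η) :
    UniformCauchySeqOn (fun n => fderiv ℝ (u n)) atTop univ := by
  rw [Metric.uniformCauchySeqOn_iff]
  intro δ hδ
  -- the scale `h` with `h ^ r = δ / (3 (2H + 1))`, so that `2 H h ^ r ≤ δ / 3`
  obtain ⟨h, hh, hω⟩ : ∃ h : ℝ, 0 < h ∧ 2 * H * h ^ r ≤ δ / 3 := by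
    have hq : 0 < δ / (3 * (2 * H + 1)) := by positivity
    refine ⟨(δ / (3 * (2 * H + 1))) ^ r⁻¹, Real.rpow_pos_of_pos hq _, ?_⟩
    rw [Real.rpow_inv_rpow hq.le hr.ne']
    have h1 : 2 * H / (2 * H + 1) ≤ 1 := (div_le_one (by positivity)).2 (by linarith)
    calc 2 * H * (δ / (3 * (2 * H + 1))) = δ / 3 * (2 * H / (2 * H + 1)) := by
          field_simp
      _ ≤ δ / 3 * 1 := by gcongr
      _ = δ / 3 := mul_one _
  obtain ⟨N, hN⟩ := hC (δ * h / 12) (by positivity)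
  refine ⟨N, fun n hn m hm x _ => ?_⟩
  have hdiff : Differentiable ℝ fun y => u n y - u m y := (hu n).sub (hu m)
  have hfd : ∀ y, fderiv ℝ (fun y => u n y - u m y) y = fderiv ℝ (u n) y - fderiv ℝ (u m) y :=
    fun y => fderiv_fun_sub ((hu n) y) ((hu m) y)
  have hmod : ∀ y ∈ closedBall x h, ‖fderiv ℝ (fun y => u n y - u m y) y -
      fderiv ℝ (fun y => u n y - u m y) x‖ ≤ 2 * H * h ^ r := by
    intro y hy
    rw [hfd, hfd]
    rw [mem_closedBall, dist_eq_norm] at hy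
    calc ‖fderiv ℝ (u n) y - fderiv ℝ (u m) y - (fderiv ℝ (u n) x - fderiv ℝ (u m) x)‖
        = ‖(fderiv ℝ (u n) y - fderiv ℝ (u n) x) - (fderiv ℝ (u m) y - fderiv ℝ (u m) x)‖ := by
          congr 1
          abel
      _ ≤ ‖fderiv ℝ (u n) y - fderiv ℝ (u n) x‖ + ‖fderiv ℝ (u m) y - fderiv ℝ (u m) x‖ :=
          norm_sub_le _ _
      _ ≤ H * ‖y - x‖ ^ r + H * ‖y - x‖ ^ r := add_le_add (hHol n y x) (hHol m y x)
      _ ≤ H * h ^ r + H * h ^ r := by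
          have : ‖y - x‖ ^ r ≤ h ^ r := Real.rpow_le_rpow (norm_nonneg _) hy hr.le
          gcongr
      _ = 2 * H * h ^ r := by ring
  have key := norm_fderiv_le_of_modulus hdiff hh (fun y => hN n hn m hm y) x hmod
  rw [dist_eq_norm, ← hfd]
  calc ‖fderiv ℝ (fun y => u n y - u m y) x‖ ≤ 2 * (δ * h / 12) / h + 2 * H * h ^ r := key
    _ = δ / 6 + 2 * H * h ^ r := by
        congr 1
        field_simp
        ring
    _ < δ := by linarith

/-- **The `C¹` limit.** If the `u n : X → G` (`G` complete) are differentiable, converge pointwise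
to `v`, and their derivatives are uniformly Cauchy on `X`, then `v` is differentiable and
`D(u n) → Dv` uniformly on `X` (`hasFDerivAt_of_tendstoUniformly`). [folklore] -/
theorem exists_hasFDerivAt_of_uniformCauchySeqOn_fderiv {X G : Type*} [NormedAddCommGroup X]
    [NormedSpace ℝ X] [NormedAddCommGroup G] [NormedSpace ℝ G] [CompleteSpace G]
    {u : ℕ → X → G} {v : X → G} (hu : ∀ n, Differentiable ℝ (u n))
    (hU : UniformCauchySeqOn (fun n => fderiv ℝ (u n)) atTop univ)
    (hv : ∀ x, Tendsto (fun n => u n x) atTop (𝓝 (v x))) :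
    ∃ D : X → X →L[ℝ] G, (∀ x, HasFDerivAt v (D x) x) ∧
      TendstoUniformly (fun n => fderiv ℝ (u n)) D atTop := by
  have hpt : ∀ x, ∃ L, Tendsto (fun n => fderiv ℝ (u n) x) atTop (𝓝 L) := fun x =>
    cauchySeq_tendsto_of_complete (hU.cauchySeq (mem_univ x))
  choose D hD using hpt
  have hunif : TendstoUniformly (fun n => fderiv ℝ (u n)) D atTop :=
    tendstoUniformlyOn_univ.mp (hU.tendstoUniformlyOn_of_tendsto fun x _ => hD x)
  exact ⟨D, fun x => hasFDerivAt_of_tendstoUniformly hunif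
    (fun n x => ((hu n) x).hasFDerivAt) hv x, hunif⟩

end Helpers

/-! ### The extension theorem -/

/-- **The Cauchy transform on `C^{0,r}` densities supported in a disc** (Vekua 1962, Thm. 1.32,
reduced to the smooth a priori estimate). Let `0 < r < 1` and assume the a priori `C^{1,r}`
estimate `CauchyTransformHolderApriori F r` for smooth densities. Then for every `ρ > 0` there is
`C ≥ 0` such that for every CONTINUOUS `g : ℂ → F` vanishing for `‖z‖ ≥ ρ`, with `‖g‖ ≤ K₀` and
`‖g z - g z'‖ ≤ K₁ ‖z - z'‖ ^ r`: `T g ∈ C¹`, `∂̄ (T g) = g`, `‖T g‖ ≤ C K₀`,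
`‖D(T g)‖ ≤ C (K₀ + K₁)` and `‖D(T g)(z) - D(T g)(z')‖ ≤ C (K₀ + K₁) ‖z - z'‖ ^ r`
(mollification, uniform convergence of `T gₙ` and — by interpolation — of `D(T gₙ)`).
[folklore] -/
theorem cauchyTransform_holder_of_apriori (F : Type) [NormedAddCommGroup F] [NormedSpace ℂ F]
    [CompleteSpace F] [FiniteDimensional ℂ F]
    {r : ℝ≥0} (hr : 0 < r) (hr1 : r < 1) (hT : CauchyTransformHolderApriori F r) :
    ∀ ρ : ℝ, 0 < ρ → ∃ C : ℝ, 0 ≤ C ∧ ∀ g : ℂ → F, Continuous g → (∀ z, ρ ≤ ‖z‖ → g z = 0) →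
    ∀ K₀ K₁ : ℝ, 0 ≤ K₀ → 0 ≤ K₁ → (∀ z, ‖g z‖ ≤ K₀) →
      (∀ z z', ‖g z - g z'‖ ≤ K₁ * ‖z - z'‖ ^ (r : ℝ)) →
      ContDiff ℝ 1 (cauchyTransformAlong (1 : ℂ) g) ∧
      (∀ z, dbarAlong (1 : ℂ) (cauchyTransformAlong (1 : ℂ) g) z = g z) ∧
      (∀ z, ‖cauchyTransformAlong (1 : ℂ) g z‖ ≤ C * K₀) ∧
      (∀ z, ‖fderiv ℝ (cauchyTransformAlong (1 : ℂ) g) z‖ ≤ C * (K₀ + K₁)) ∧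
      (∀ z z', ‖fderiv ℝ (cauchyTransformAlong (1 : ℂ) g) z -
          fderiv ℝ (cauchyTransformAlong (1 : ℂ) g) z'‖ ≤ C * (K₀ + K₁) * ‖z - z'‖ ^ (r : ℝ)) := by
  have _ := hr1
  intro ρ hρ
  obtain ⟨C, hC0, hC⟩ := hT (2 * ρ) (by positivity)
  refine ⟨C, hC0, fun g hg hgρ K₀ K₁ hK₀ hK₁ hg0 hg1 => ?_⟩
  have hr' : 0 < (r : ℝ) := hr
  -- support of `g`
  have hgt : tsupport g ⊆ closedBall (0 : ℂ) ρ := tsupport_subset_closedBall_of_eq_zero hgρ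
  have hgc : HasCompactSupport g :=
    IsCompact.of_isClosed_subset (isCompact_closedBall _ _) (isClosed_tsupport g) hgt
  have hg2ρ : ∀ z, g z ≠ 0 → ‖z‖ < 2 * ρ := fun z hz => by
    by_contra h
    exact hz (hgρ z (by linarith [not_lt.1 h]))
  -- `g` is `r`-Hölder with constant `K₁`
  have hgH : HolderWith K₁.toNNReal r g := holderWith_of_dist_le fun x y => by
    rw [dist_eq_norm, dist_eq_norm, Real.coe_toNNReal K₁ hK₁]
    exact hg1 x y
  -- the mollifying scales `εₙ ∈ (0, ρ)`, `εₙ → 0`, and the mollified densities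
  obtain ⟨ε, -, hεI, hε0⟩ := exists_seq_strictAnti_tendsto' hρ
  choose gs hgs_smooth hgs_bd hgs_hol hgs_dist hgs_supp using fun n : ℕ =>
    exists_contDiff_approx_of_holderWith (E := ℂ) hg hg0 hgH (hεI n).1
  have hgs_t : ∀ n, tsupport (gs n) ⊆ closedBall (0 : ℂ) (ε n + ρ) := fun n =>
    (hgs_supp n).trans ((cthickening_subset_of_subset _ hgt).trans
      (cthickening_closedBall (hεI n).1.le hρ.le (0 : ℂ)).subset)
  have hgs_c : ∀ n, HasCompactSupport (gs n) := fun n =>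
    IsCompact.of_isClosed_subset (isCompact_closedBall _ _) (isClosed_tsupport _) (hgs_t n)
  have hgs_zero : ∀ n z, 2 * ρ ≤ ‖z‖ → gs n z = 0 := fun n z hz => by
    apply image_eq_zero_of_notMem_tsupport
    intro h
    have h' := hgs_t n h
    rw [mem_closedBall, dist_zero_right] at h'
    linarith [(hεI n).2]
  have hgs_2ρ : ∀ n z, gs n z ≠ 0 → ‖z‖ < 2 * ρ := fun n z hz => by
    by_contra h
    exact hz (hgs_zero n z (not_lt.1 h))
  have hgs_hol' : ∀ n z z', ‖gs n z - gs n z'‖ ≤ K₁ * ‖z - z'‖ ^ (r : ℝ) := fun n z z' => by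
    have h := (hgs_hol n).dist_le z z'
    rwa [dist_eq_norm, dist_eq_norm, Real.coe_toNNReal K₁ hK₁] at h
  have hgs_d : ∀ n z, ‖gs n z - g z‖ ≤ K₁ * ε n ^ (r : ℝ) := fun n z => by
    have h := hgs_dist n z
    rwa [dist_eq_norm, Real.coe_toNNReal K₁ hK₁] at h
  have hεr : ∀ n, 0 ≤ K₁ * ε n ^ (r : ℝ) := fun n =>
    mul_nonneg hK₁ (Real.rpow_nonneg (hεI n).1.le _)
  -- the a priori estimate for the mollified densities (radius `2ρ`)
  have hap : ∀ n, (∀ z, ‖cauchyTransformAlong (1 : ℂ) (gs n) z‖ ≤ C * K₀) ∧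
      (∀ z, ‖fderiv ℝ (cauchyTransformAlong (1 : ℂ) (gs n)) z‖ ≤ C * (K₀ + K₁)) ∧
      ∀ z z', ‖fderiv ℝ (cauchyTransformAlong (1 : ℂ) (gs n)) z -
          fderiv ℝ (cauchyTransformAlong (1 : ℂ) (gs n)) z'‖ ≤
        C * (K₀ + K₁) * ‖z - z'‖ ^ (r : ℝ) :=
    fun n => hC (gs n) (hgs_smooth n) (hgs_zero n) K₀ K₁ hK₀ hK₁ (hgs_bd n) (hgs_hol' n)
  -- smoothness of `T gₙ`
  have hTs : ∀ n, ContDiff ℝ ∞ (cauchyTransformAlong (1 : ℂ) (gs n)) := fun n =>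
    contDiff_cauchyTransformAlong (hgs_smooth n) (hgs_c n) one_ne_zero
  have hTd : ∀ n, Differentiable ℝ (cauchyTransformAlong (1 : ℂ) (gs n)) := fun n =>
    (hTs n).differentiable (by simp)
  -- the rate `K₁ εₙ ^ r → 0`
  have hrate : Tendsto (fun n => K₁ * ε n ^ (r : ℝ)) atTop (𝓝 0) := by
    have h := (hε0.rpow_const_nhds_zero hr').const_mul K₁
    rwa [mul_zero] at h
  -- pointwise convergence `T gₙ z → T g z`
  have hTpt : ∀ z, Tendsto (fun n => cauchyTransformAlong (1 : ℂ) (gs n) z) atTop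
      (𝓝 (cauchyTransformAlong (1 : ℂ) g z)) := fun z => by
    rw [tendsto_iff_norm_sub_tendsto_zero]
    refine squeeze_zero (fun n => norm_nonneg _) (fun n =>
      SimilarityVector.norm_cauchyTransform_sub_le_global (hgs_smooth n).continuous (hgs_c n)
        hg hgc (by positivity : (0 : ℝ) ≤ 2 * ρ) (hεr n) (hgs_2ρ n) hg2ρ
        (fun w _ => hgs_d n w) z) ?_
    have h := hrate.const_mul (2 * (‖z‖ + 2 * ρ))
    rwa [mul_zero] at h
  -- `T gₙ` is uniformly Cauchy in sup norm
  have hTC : ∀ η > 0, ∃ N, ∀ n ≥ N, ∀ m ≥ N, ∀ x,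
      ‖cauchyTransformAlong (1 : ℂ) (gs n) x - cauchyTransformAlong (1 : ℂ) (gs m) x‖ ≤ η := by
    intro η hη
    obtain ⟨N, hN⟩ := (Metric.tendsto_atTop.1 hrate) (η / (12 * ρ + 1) / 2) (by positivity)
    refine ⟨N, fun n hn m hm x => ?_⟩
    have hn' := hN n hn
    have hm' := hN m hm
    rw [Real.dist_eq, sub_zero, abs_of_nonneg (hεr _)] at hn' hm'
    rw [← SimilarityVector.cauchyTransform_sub (hgs_smooth n).continuous (hgs_c n)
      (hgs_smooth m).continuous (hgs_c m)]
    have hs : ∀ z, (gs n - gs m) z ≠ 0 → ‖z‖ < 2 * ρ := fun z hz => by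
      by_contra h
      have h1 := hgs_zero n z (not_lt.1 h)
      have h2 := hgs_zero m z (not_lt.1 h)
      exact hz (by simp [h1, h2])
    have hb : ∀ z, ‖(gs n - gs m) z‖ ≤ K₁ * ε n ^ (r : ℝ) + K₁ * ε m ^ (r : ℝ) := fun z => by
      calc ‖(gs n - gs m) z‖ = ‖(gs n z - g z) - (gs m z - g z)‖ := by
            rw [Pi.sub_apply, sub_sub_sub_cancel_right]
        _ ≤ ‖gs n z - g z‖ + ‖gs m z - g z‖ := norm_sub_le _ _
        _ ≤ _ := add_le_add (hgs_d n z) (hgs_d m z)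
    have key := norm_cauchyTransform_le_uniform (by positivity : (0 : ℝ) ≤ 2 * ρ)
      (add_nonneg (hεr n) (hεr m)) hs hb x
    have h1 : 12 * ρ / (12 * ρ + 1) ≤ 1 := (div_le_one (by positivity)).2 (by linarith)
    calc ‖cauchyTransformAlong (1 : ℂ) (gs n - gs m) x‖
          ≤ 6 * (2 * ρ) * (K₁ * ε n ^ (r : ℝ) + K₁ * ε m ^ (r : ℝ)) := key
      _ ≤ 6 * (2 * ρ) * (η / (12 * ρ + 1) / 2 + η / (12 * ρ + 1) / 2) := by gcongr
      _ = η * (12 * ρ / (12 * ρ + 1)) := by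
          field_simp
          ring
      _ ≤ η * 1 := by gcongr
      _ = η := mul_one η
  -- the derivatives are uniformly Cauchy (interpolation), hence converge uniformly
  have hU : UniformCauchySeqOn (fun n => fderiv ℝ (cauchyTransformAlong (1 : ℂ) (gs n)))
      atTop univ :=
    uniformCauchySeqOn_fderiv_of_holder hTd (by positivity : 0 ≤ C * (K₀ + K₁)) hr'
      (fun n => (hap n).2.2) hTC
  obtain ⟨D, hD, hDu⟩ := exists_hasFDerivAt_of_uniformCauchySeqOn_fderiv hTd hU hTpt
  have hfd : ∀ z, fderiv ℝ (cauchyTransformAlong (1 : ℂ) g) z = D z := fun z => (hD z).fderiv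
  have hDpt : ∀ z, Tendsto (fun n => fderiv ℝ (cauchyTransformAlong (1 : ℂ) (gs n)) z) atTop
      (𝓝 (D z)) := hDu.tendsto_at
  refine ⟨?_, fun z => ?_, fun z => ?_, fun z => ?_, fun z z' => ?_⟩
  · -- `T g ∈ C¹`
    rw [contDiff_one_iff_fderiv]
    refine ⟨fun z => (hD z).differentiableAt, ?_⟩
    rw [show fderiv ℝ (cauchyTransformAlong (1 : ℂ) g) = D from funext hfd]
    exact hDu.continuous (Frequently.of_forall fun n => (hTs n).continuous_fderiv (by simp))
  · -- `∂̄ (T g) = g`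
    have h1 : Tendsto (fun n => dbarAlong (1 : ℂ) (cauchyTransformAlong (1 : ℂ) (gs n)) z) atTop
        (𝓝 (dbarAlong (1 : ℂ) (cauchyTransformAlong (1 : ℂ) g) z)) := by
      simp only [dbarAlong_one]
      have hΦ : Continuous fun L : ℂ →L[ℝ] F =>
          (2 : ℂ)⁻¹ • (L 1 + Complex.I • L Complex.I) := by fun_prop
      rw [hfd z]
      exact (hΦ.tendsto (D z)).comp (hDpt z)
    have h2 : Tendsto (fun n => dbarAlong (1 : ℂ) (cauchyTransformAlong (1 : ℂ) (gs n)) z) atTop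
        (𝓝 (g z)) := by
      have heq : ∀ n, dbarAlong (1 : ℂ) (cauchyTransformAlong (1 : ℂ) (gs n)) z = gs n z := fun n =>
        dbarAlong_cauchyTransformAlong ((hgs_smooth n).of_le (by exact_mod_cast le_top))
          (hgs_c n) one_ne_zero z
      simp only [heq]
      rw [tendsto_iff_norm_sub_tendsto_zero]
      exact squeeze_zero (fun n => norm_nonneg _) (fun n => hgs_d n z) hrate
    exact tendsto_nhds_unique h1 h2
  · -- sup bound
    exact le_of_tendsto' (hTpt z).norm fun n => (hap n).1 z
  · -- derivative bound
    rw [hfd z]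
    exact le_of_tendsto' (hDpt z).norm fun n => (hap n).2.1 z
  · -- Hölder bound for the derivative
    rw [hfd z, hfd z']
    exact le_of_tendsto' ((hDpt z).sub (hDpt z')).norm fun n => (hap n).2.2 z z'

end Literature.Analysis.Complex

end
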